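import Summits.ResolutionOfSingularities.ResolutionOfSingularities.Theorems.FrobeniusClosingSteerLowOrderAbsorbingCore
import Summits.ResolutionOfSingularities.ResolutionOfSingularities.Theorems.FrobeniusClosingSteerLowOrderAbsorbingChart
import Summits.ResolutionOfSingularities.ResolutionOfSingularities.Theorems.FrobeniusClosingSteerCore4SteeredRegular
import Literature.AlgebraicGeometry.Resolution.RegularCentreRsopPart
import Literature.AlgebraicGeometry.Resolution.SymbolicPowersRsop
import Mathlib.Algebra.CharP.Two
import Mathlib.Algebra.CharP.Quotient
import HarnessLib

/-!
# «Low order is absorbing» at `p = 2` — the one-step theorem (chain W4.1, crux `Steer`, §σ2.17/§σ2.19)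

OURS (campaign res-hironaka, rung L, slot W4.1; helper for crux `Steer` stmt-ResolutionOfSingularities-16345:
the content of res-L0-w41-tri-2's stub candidate `lowOrder_step_two`
(`L/res-L0-w41-tri-2/s17/R2TwoSigma-s17-tri2.delta.lean`) in DEF-FREE form; the skeleton's
`IsSteeredRun`/`IsSigmaTopCentre`/`IsStrictStepAlong`/`IsHighOrderAt` enter through exactly the fields
used, and the adoption leaf belongs to the holder's skeleton). NOT a statement of any manuscript;
AI-written, weaker than expert review.
`not_highOrder_of_step_two`: in characteristic `2`, if no cleaning `f − h²` of `f = s²` lies in `𝔪³`,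
then after one σ_top step no cleaning `s'² − h'²` lies in `𝔪'³`. Proof: the derivation argument of
`…LowOrderAbsorbingCore` through the chart plumbing of `…LowOrderAbsorbingChart` — `P = (c)` by part of
a regular system of parameters, `R' = (R[c/cᵢ])_{centre}`, `f − g₀² = cᵢ² · Q(c/cᵢ)`, a high-order
cleaning upstairs gives `U² Q − A² ∈ 𝔑³ + P·R[T]`, hence in `(R/P)[T]` every polar coefficient of `Q`
lies in `𝔪`, and `f − (g₀ + b)² ∈ 𝔪³` at the old stage. Uniform in the height of the centre and in the
residue field of the new point. [cite: StacksProject, Tag 0BIQ] [cite: Matsumura1987, Thm. 14.2] [folklore]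
-/

noncomputable section

-- `Summit.<S>.<S>.…` duplicates the summit name by design (single-problem summit).
set_option linter.dupNamespace false

open IsLocalRing MvPolynomial Literature.AlgebraicGeometry.Resolution
open Summit.ResolutionOfSingularities.ResolutionOfSingularities.Theorems.SwitchingDichotomy.SteeredRun
  (isLocalBlowupAlong_unique isLocalBlowupAlong_of_generators)
open scoped BigOperators

namespace Summit.ResolutionOfSingularities.ResolutionOfSingularities.Theorems.SwitchingDichotomy.LowOrderAbsorbing

variable {K : Type} [Field K]

/-- The maximal ideal of a local subring known to be `B_{𝔪_O ∩ B}` is the centre of `O`. [folklore] -/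
theorem mem_maximalIdeal_iff_of_eq_locAtCentre {O : ValuationSubring K} {B : Subring K}
    (hBO : B ≤ O.toSubring) (S : Subring K) [IsLocalRing S] (hS : S = locAtCentre B O) (r : S) :
    r ∈ maximalIdeal S ↔ O.valuation (r : K) < 1 := by
  subst hS
  exact mem_maximalIdeal_locAtCentre_iff hBO r

/-- Representation of elements of `𝔪_Sⁿ` for a local subring `S` KNOWN to be `B_{𝔪_O ∩ B}` with
`B = φ(A)` (`exists_rep_of_mem_pow`, transported along the equalities). [folklore] -/
theorem exists_rep_of_mem_pow' {A : Type*} [CommRing A] (φ : A →+* K) (O : ValuationSubring K)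
    (hφO : ∀ a, φ a ∈ O) (B : Subring K) (hB : φ.range = B) (S : Subring K) [IsLocalRing S]
    (hS : S = locAtCentre B O) :
    ∀ (n : ℕ) (z : S), z ∈ maximalIdeal S ^ n →
      ∃ a u : A, a ∈ ((maximalIdeal O).comap (φ.codRestrict O.toSubring hφO)) ^ n ∧
        O.valuation (φ u) = 1 ∧ (z : K) = φ a / φ u := by
  subst hB; subst hS
  intro n z hz
  exact exists_rep_of_mem_pow φ O hφO n z hz

/-- **Low order is absorbing — one σ_top step at `p = 2`, def-free form.** `R ⊆ K` (`char K = 2`) regular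
local, the local ring of some `B ⊆ O` at the centre of `O`, residues squares; `P ≤ 𝔪_R` with `R ⧸ P`
regular (permissible centre or the closed point); `f − g₀² ∈ P²`; `R'` the local blowing up along `P`,
regular; `x ∈ P ∖ 0` of maximal value, `g ∈ R`, `s = x·s' + g`, `s² = f`, `s'² ∈ R'`. If no `f − h²`
lies in `𝔪_R³` then no `s'² − h'²` lies in `𝔪_{R'}³`. [cite: StacksProject, Tag 0BIQ] [cite: Matsumura1987, Thm. 14.2] -/
theorem not_highOrder_of_step_two [CharP K 2] (O : ValuationSubring K) (R R' : Subring K)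
    [IsRegularLocalRing R] [IsRegularLocalRing R']
    (hR : ∃ B : Subring K, B ≤ O.toSubring ∧ R = locAtCentre B O)
    (hperf : ∀ a : R, ∃ b : R, a - b ^ 2 ∈ maximalIdeal R)
    (P : Ideal R) (hPle : P ≤ maximalIdeal R) (hPreg : IsRegularLocalRing (R ⧸ P))
    (f g₀ : R) (hg₀ : f - g₀ ^ 2 ∈ P ^ 2)
    (hbl : IsLocalBlowupAlong O R P R')
    (x : K) (hxR : x ∈ R) (hxP : (⟨x, hxR⟩ : R) ∈ P) (hx0 : x ≠ 0)
    (hxmax : ∀ y : R, y ∈ P → O.valuation (y : K) ≤ O.valuation x)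
    (g : K) (hg : g ∈ R) (s s' : K) (hs : s ^ 2 = (f : K)) (hstep : s = x * s' + g)
    (hs' : s' ^ 2 ∈ R')
    (hlow : ∀ h : R, f - h ^ 2 ∉ maximalIdeal R ^ 3) :
    ∀ h' : R', (⟨s' ^ 2, hs'⟩ : R') - h' ^ 2 ∉ maximalIdeal R' ^ 3 := by
  classical
  intro h' hhigh
  have hRO : R ≤ O.toSubring := hbl.1
  have h2K : (2 : K) = 0 := by
    have := CharP.cast_eq_zero K 2
    simpa using this
  haveI : CharP R 2 := by
    refine CharTwo.of_one_ne_zero_of_two_eq_zero one_ne_zero (Subtype.ext ?_)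
    push_cast
    exact h2K
  haveI : CharP R' 2 := by
    refine CharTwo.of_one_ne_zero_of_two_eq_zero one_ne_zero (Subtype.ext ?_)
    push_cast
    exact h2K
  have hvm : ∀ r : R, r ∈ maximalIdeal R ↔ O.valuation (r : K) < 1 := by
    obtain ⟨B, hB, hRB⟩ := hR
    exact mem_maximalIdeal_iff_of_eq_locAtCentre hB R hRB
  haveI := hPreg
  obtain ⟨h, c, hc, hcP⟩ := exists_isRsopPart_span_range_eq (R := R) hPle
  have hqr : IsQuasiRegular c := by
    obtain ⟨e, y, hd, hy, hyc⟩ := hc.exists_rsop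
    have hq := isQuasiRegular_rsop_comp hd y hy (Fin.castAdd e) (Fin.castAdd_injective _ _)
    have hcomp : y ∘ Fin.castAdd e = c := funext fun j => hyc j
    rwa [hcomp] at hq
  have hcPmem : ∀ j, c j ∈ P := fun j => hcP ▸ Ideal.subset_span ⟨j, rfl⟩
  have hcm : ∀ j, c j ∈ maximalIdeal R := fun j => hPle (hcPmem j)
  have hne : ∃ j ∈ (Finset.univ : Finset (Fin h)), ((c j : R) : K) ≠ 0 := by
    by_contra hcon
    have hall : ∀ j, c j = 0 := fun j => by
      by_contra hj
      exact hcon ⟨j, Finset.mem_univ j, fun h0 => hj (Subtype.ext h0)⟩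
    have hbot : Ideal.span (Set.range c) = ⊥ := by
      rw [Ideal.span_eq_bot]; rintro _ ⟨j, rfl⟩; exact hall j
    rw [hcP] at hbot
    rw [hbot] at hxP
    exact hx0 (congrArg Subtype.val ((Submodule.mem_bot _).mp hxP))
  obtain ⟨i, -, hci, hmax⟩ := exists_max_valuation O Finset.univ (fun j => ((c j : R) : K)) hne
  have hci' : c i ≠ 0 := fun h0 => hci (by rw [h0]; rfl)
  have hxsum : ∃ rj : Fin h → R, x = ∑ j, ((rj j : R) : K) * ((c j : R) : K) := by
    have hxspan : (⟨x, hxR⟩ : R) ∈ Ideal.span (Set.range c) := hcP ▸ hxP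
    obtain ⟨rj, hrj⟩ := Ideal.mem_span_range_iff_exists_fun.mp hxspan
    refine ⟨rj, ?_⟩
    calc x = R.subtype (∑ j, rj j * c j) := by rw [hrj]; rfl
      _ = ∑ j, ((rj j : R) : K) * ((c j : R) : K) := by
        rw [map_sum]
        exact Finset.sum_congr rfl fun j _ => by rw [map_mul]; rfl
  have hvx : O.valuation ((c i : R) : K) = O.valuation x := by
    apply le_antisymm (hxmax _ (hcPmem i))
    obtain ⟨rj, hrj⟩ := hxsum
    rw [hrj]
    refine Valuation.map_sum_le _ fun j _ => ?_
    rw [map_mul]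
    calc O.valuation ((rj j : R) : K) * O.valuation ((c j : R) : K)
        ≤ 1 * O.valuation ((c i : R) : K) :=
          mul_le_mul' ((O.valuation_le_one_iff _).mpr (hRO (rj j).2)) (hmax j (Finset.mem_univ j))
      _ = O.valuation ((c i : R) : K) := one_mul _
  obtain ⟨Ev, hEv⟩ : ∃ Ev : MvPolynomial {j : Fin h // j ≠ i} R →+* K,
      Ev = MvPolynomial.eval₂Hom R.subtype
        (fun j : {j : Fin h // j ≠ i} => ((c j.1 : R) : K) / (c i : R)) := ⟨_, rfl⟩
  obtain ⟨C, hC⟩ : ∃ C : Subring K,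
      C = Subring.closure ((R : Set K) ∪ (fun y : R => (y : K) / (c i : R)) '' Set.range c) :=
    ⟨_, rfl⟩
  have hCrange : Ev.range = C := by rw [hEv, hC]; exact range_ev R c i hci
  have hR'eq : R' = locAtCentre C O := by
    rw [hC]
    exact isLocalBlowupAlong_unique hbl
      (isLocalBlowupAlong_of_generators hRO c hcP i hci' (fun j => hmax j (Finset.mem_univ j)))
  have hCR' : C ≤ R' := hR'eq ▸ le_locAtCentre C O
  have hR'O : R' ≤ O.toSubring := hbl.isLocalBlowup.target_le
  have hCO : C ≤ O.toSubring := hCR'.trans hR'O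
  have hEvC : ∀ G, Ev G ∈ C := fun G => hCrange ▸ ⟨G, rfl⟩
  have hEvO : ∀ G, Ev G ∈ O := fun G => hCO (hEvC G)
  have hEvR' : ∀ G, Ev G ∈ R' := fun G => hCR' (hEvC G)
  have hRR' : R ≤ R' := hbl.isLocalBlowup.le
  have hEvX : ∀ a : {j : Fin h // j ≠ i}, Ev (MvPolynomial.X a) = ((c a.1 : R) : K) / (c i : R) :=
    fun a => by rw [hEv, MvPolynomial.coe_eval₂Hom, MvPolynomial.eval₂_X]
  have hEvCst : ∀ r : R, Ev (MvPolynomial.C r) = (r : K) := fun r => by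
    rw [hEv, MvPolynomial.coe_eval₂Hom, MvPolynomial.eval₂_C]; rfl
  obtain ⟨N, hN⟩ : ∃ N : Ideal (MvPolynomial {j : Fin h // j ≠ i} R),
      N = (maximalIdeal O).comap (Ev.codRestrict O.toSubring hEvO) := ⟨_, rfl⟩
  have hNmem : ∀ G, G ∈ N ↔ O.valuation (Ev G) < 1 := by
    intro G
    rw [hN, Ideal.mem_comap, ValuationSubring.valuation_lt_one_iff]
    rfl
  haveI hNprime : N.IsPrime := by rw [hN]; exact Ideal.IsPrime.comap _
  have hsq2 : (f - g₀ ^ 2) ∈ Ideal.span (Set.range fun p : Fin h × Fin h => c p.1 * c p.2) := by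
    have h1 : P ^ 2 ≤ Ideal.span (Set.range fun p : Fin h × Fin h => c p.1 * c p.2) := by
      rw [pow_two, ← hcP, Ideal.span_mul_span']
      apply Ideal.span_mono
      rintro _ ⟨_, ⟨a, rfl⟩, _, ⟨b, rfl⟩, rfl⟩
      exact ⟨(a, b), rfl⟩
    exact h1 hg₀
  obtain ⟨q, hq⟩ := Ideal.mem_span_range_iff_exists_fun.mp hsq2
  have hqK : ((f - g₀ ^ 2 : R) : K) = ∑ a : Fin h, ∑ b : Fin h,
      ((q (a, b) : R) : K) * ((c a : R) : K) * ((c b : R) : K) := by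
    rw [← hq]
    have := map_sum R.subtype (fun p : Fin h × Fin h => q p * (c p.1 * c p.2)) Finset.univ
    simp only [Subring.coe_subtype] at this
    rw [show ((∑ p : Fin h × Fin h, q p * (c p.1 * c p.2) : R) : K) =
      ∑ p : Fin h × Fin h, ((q p * (c p.1 * c p.2) : R) : K) from this, Fintype.sum_prod_type]
    apply Finset.sum_congr rfl; intro a _
    apply Finset.sum_congr rfl; intro b _
    push_cast; ring
  obtain ⟨Qt, hQt⟩ : ∃ Qt : MvPolynomial {j : Fin h // j ≠ i} R, Qt =
    ∑ a : {j : Fin h // j ≠ i}, ∑ b : {j : Fin h // j ≠ i},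
        MvPolynomial.C (q (a.1, b.1)) * MvPolynomial.X a * MvPolynomial.X b +
      ∑ b : {j : Fin h // j ≠ i}, MvPolynomial.C (q (b.1, i) + q (i, b.1)) * MvPolynomial.X b +
      MvPolynomial.C (q (i, i)) := ⟨_, rfl⟩
  have hsplit : ∀ (F : Fin h → K), (∑ a : Fin h, F a) = F i + ∑ a : {j : Fin h // j ≠ i}, F a.1 := by
    intro F
    rw [← Finset.add_sum_erase Finset.univ F (Finset.mem_univ i)]
    congr 1
    exact Finset.sum_subtype (Finset.univ.erase i) (p := fun j => j ≠ i) (by simp) F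
  have hcc : ∀ j : Fin h, ((c j : R) : K) / ((c i : R) : K) * ((c i : R) : K) = ((c j : R) : K) :=
    fun j => div_mul_cancel₀ _ hci
  have hsplit2 : ∀ (F : Fin h → Fin h → K), (∑ a : Fin h, ∑ b : Fin h, F a b) =
      F i i + ∑ b : {j : Fin h // j ≠ i}, F i b.1 + ∑ a : {j : Fin h // j ≠ i}, F a.1 i +
        ∑ a : {j : Fin h // j ≠ i}, ∑ b : {j : Fin h // j ≠ i}, F a.1 b.1 := by
    intro F
    rw [hsplit (fun a => ∑ b : Fin h, F a b), hsplit (fun b => F i b)]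
    have hin : ∀ a : {j : Fin h // j ≠ i}, (∑ b : Fin h, F a.1 b) =
        F a.1 i + ∑ b : {j : Fin h // j ≠ i}, F a.1 b.1 := fun a => hsplit (fun b => F a.1 b)
    rw [Finset.sum_congr rfl (fun a _ => hin a), Finset.sum_add_distrib]
    ring
  have hEvQt : Ev Qt = ∑ a : {j : Fin h // j ≠ i}, ∑ b : {j : Fin h // j ≠ i},
      ((q (a.1, b.1) : R) : K) * (((c a.1 : R) : K) / ((c i : R) : K)) *
        (((c b.1 : R) : K) / ((c i : R) : K)) +
      ∑ b : {j : Fin h // j ≠ i}, ((q (b.1, i) + q (i, b.1) : R) : K) *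
        (((c b.1 : R) : K) / ((c i : R) : K)) + ((q (i, i) : R) : K) := by
    rw [hQt]
    simp only [map_add, map_sum, map_mul, hEvX, hEvCst]
    push_cast
    ring
  have hF₀ : ((f - g₀ ^ 2 : R) : K) = Ev Qt * ((c i : R) : K) ^ 2 := by
    have e1 : ∀ a b : {j : Fin h // j ≠ i},
        ((q (a.1, b.1) : R) : K) * (((c a.1 : R) : K) / ((c i : R) : K)) *
          (((c b.1 : R) : K) / ((c i : R) : K)) * ((c i : R) : K) ^ 2 =
        ((q (a.1, b.1) : R) : K) * ((c a.1 : R) : K) * ((c b.1 : R) : K) := by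
      intro a b
      calc _ = ((q (a.1, b.1) : R) : K) * ((((c a.1 : R) : K) / ((c i : R) : K)) * ((c i : R) : K)) *
            ((((c b.1 : R) : K) / ((c i : R) : K)) * ((c i : R) : K)) := by ring
        _ = _ := by rw [hcc, hcc]
    have e2 : ∀ b : {j : Fin h // j ≠ i},
        ((q (b.1, i) + q (i, b.1) : R) : K) * (((c b.1 : R) : K) / ((c i : R) : K)) *
          ((c i : R) : K) ^ 2 =
        ((q (i, b.1) : R) : K) * ((c i : R) : K) * ((c b.1 : R) : K) +
          ((q (b.1, i) : R) : K) * ((c b.1 : R) : K) * ((c i : R) : K) := by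
      intro b
      calc _ = ((q (b.1, i) + q (i, b.1) : R) : K) *
            ((((c b.1 : R) : K) / ((c i : R) : K)) * ((c i : R) : K)) * ((c i : R) : K) := by ring
        _ = _ := by rw [hcc]; push_cast; ring
    have hA : (∑ a : {j : Fin h // j ≠ i}, ∑ b : {j : Fin h // j ≠ i},
        ((q (a.1, b.1) : R) : K) * (((c a.1 : R) : K) / ((c i : R) : K)) *
          (((c b.1 : R) : K) / ((c i : R) : K))) * ((c i : R) : K) ^ 2 =
        ∑ a : {j : Fin h // j ≠ i}, ∑ b : {j : Fin h // j ≠ i},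
          ((q (a.1, b.1) : R) : K) * ((c a.1 : R) : K) * ((c b.1 : R) : K) := by
      rw [Finset.sum_mul]
      refine Finset.sum_congr rfl fun a _ => ?_
      rw [Finset.sum_mul]
      exact Finset.sum_congr rfl fun b _ => e1 a b
    have hB : (∑ b : {j : Fin h // j ≠ i}, ((q (b.1, i) + q (i, b.1) : R) : K) *
        (((c b.1 : R) : K) / ((c i : R) : K))) * ((c i : R) : K) ^ 2 =
        ∑ b : {j : Fin h // j ≠ i}, ((q (i, b.1) : R) : K) * ((c i : R) : K) * ((c b.1 : R) : K) +
          ∑ a : {j : Fin h // j ≠ i}, ((q (a.1, i) : R) : K) * ((c a.1 : R) : K) * ((c i : R) : K) := by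
      rw [Finset.sum_mul, ← Finset.sum_add_distrib]
      exact Finset.sum_congr rfl fun b _ => e2 b
    have h4 := hsplit2 (fun a b => ((q (a, b) : R) : K) * ((c a : R) : K) * ((c b : R) : K))
    rw [hqK, hEvQt, h4]
    linear_combination (-1 : K) * hA + (-1 : K) * hB
  have hρC : x / ((c i : R) : K) ∈ C := by
    obtain ⟨rj, hrj⟩ := hxsum
    rw [hrj, Finset.sum_div, hC]
    refine Subring.sum_mem _ fun j _ => ?_
    rw [mul_div_assoc]
    exact Subring.mul_mem _ (Subring.subset_closure (Or.inl (rj j).2))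
      (Subring.subset_closure (Or.inr ⟨c j, ⟨j, rfl⟩, rfl⟩))
  have hvρ : O.valuation (x / ((c i : R) : K)) = 1 := by
    rw [map_div₀, ← hvx, div_self ((map_ne_zero _).mpr hci)]
  have hρ0 : x / ((c i : R) : K) ≠ 0 := div_ne_zero hx0 hci
  have hs'2 : s' ^ 2 * x ^ 2 = (f : K) - g ^ 2 := by
    have h1 : s' * x = s - g := by rw [hstep]; ring
    rw [← mul_pow, h1, CharTwo.sub_eq_add, CharTwo.add_sq, hs, ← CharTwo.sub_eq_add]
  obtain ⟨β, hβ⟩ : ∃ β : K, β = (g - (g₀ : K)) / ((c i : R) : K) := ⟨_, rfl⟩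
  have hβsq : β ^ 2 = Ev Qt - (x / ((c i : R) : K)) ^ 2 * s' ^ 2 := by
    have h1 : (x / ((c i : R) : K)) ^ 2 * s' ^ 2 = ((f : K) - g ^ 2) / ((c i : R) : K) ^ 2 := by
      rw [← hs'2]; field_simp
    have h2 : Ev Qt = ((f : K) - (g₀ : K) ^ 2) / ((c i : R) : K) ^ 2 := by
      rw [eq_div_iff (pow_ne_zero 2 hci), ← hF₀]; push_cast; ring
    rw [h1, h2, hβ, div_pow, CharTwo.sub_eq_add, CharTwo.add_sq, div_sub_div_same]
    congr 1
    linear_combination ((g₀ : K) ^ 2) * h2K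
  have hβR' : β ∈ R' := by
    rw [hβ]
    apply mem_of_sq_mem_of_isRegularLocalRing R' (hRR' (R.sub_mem hg g₀.2)) (hRR' (c i).2)
    rw [← hβ, hβsq]
    exact R'.sub_mem (hEvR' Qt) (R'.mul_mem (R'.pow_mem (hCR' hρC) 2) hs')
  -- the high-order cleaning at the new stage, renormalised: `Ev Q̃ - (β + ρ h')² ∈ 𝔪'³`
  have hz3 : (⟨Ev Qt, hEvR' Qt⟩ - (⟨β, hβR'⟩ + ⟨x / ((c i : R) : K), hCR' hρC⟩ * h') ^ 2 : R') ∈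
      maximalIdeal R' ^ 3 := by
    have hmul := Ideal.mul_mem_left (maximalIdeal R' ^ 3)
      (⟨x / ((c i : R) : K), hCR' hρC⟩ ^ 2 : R') hhigh
    have heq : (⟨Ev Qt, hEvR' Qt⟩ - (⟨β, hβR'⟩ + ⟨x / ((c i : R) : K), hCR' hρC⟩ * h') ^ 2 : R') =
        (⟨x / ((c i : R) : K), hCR' hρC⟩ ^ 2 : R') * ((⟨s' ^ 2, hs'⟩ : R') - h' ^ 2) := by
      rw [CharTwo.add_sq]
      apply Subtype.ext
      push_cast
      rw [hβsq]
      ring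
    rw [heq]; exact hmul
  haveI : IsLocalRing R' := inferInstance
  obtain ⟨W, u₁, hW, hu₁, hzrep⟩ := exists_rep_of_mem_pow' Ev O hEvO C hCrange R' hR'eq 3 _ hz3
  obtain ⟨A, u₂, -, hu₂, hArep⟩ := exists_rep_of_mem_pow' Ev O hEvO C hCrange R' hR'eq 0
    (⟨β, hβR'⟩ + ⟨x / ((c i : R) : K), hCR' hρC⟩ * h' : R') (by simp)
  rw [← hN] at hW
  have hu₁0 : Ev u₁ ≠ 0 := ne_zero_of_valuation_eq_one hu₁
  have hu₂0 : Ev u₂ ≠ 0 := ne_zero_of_valuation_eq_one hu₂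
  have hzK : Ev Qt - (β + x / ((c i : R) : K) * h') ^ 2 = Ev W / Ev u₁ := hzrep
  have hAK : β + x / ((c i : R) : K) * h' = Ev A / Ev u₂ := hArep
  -- the upstairs relation `U² Q̃ - (A u₁)² - W u₁ u₂² ∈ ker Ev ⊆ P·R[T]`
  obtain ⟨U, hU⟩ : ∃ U : MvPolynomial {j : Fin h // j ≠ i} R, U = u₂ * u₁ := ⟨_, rfl⟩
  obtain ⟨G, hG⟩ : ∃ G : MvPolynomial {j : Fin h // j ≠ i} R,
      G = U ^ 2 * Qt - (A * u₁) ^ 2 - W * u₁ * u₂ ^ 2 := ⟨_, rfl⟩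
  have hEvG : Ev G = 0 := by
    have h3 : (Ev Qt - (Ev A / Ev u₂) ^ 2) * Ev u₁ = Ev W := by
      rw [← hAK, hzK]; field_simp
    have h4 : (Ev A / Ev u₂) ^ 2 * Ev u₂ ^ 2 = Ev A ^ 2 := by field_simp
    rw [hG, hU]
    simp only [map_sub, map_mul, map_pow]
    linear_combination (Ev u₁ * Ev u₂ ^ 2) * h3 + (Ev u₁ ^ 2) * h4
  have hGmem : G ∈ Ideal.map MvPolynomial.C (Ideal.span (Set.range c)) :=
    mem_map_C_of_ev_eq_zero R c i hci hqr (by rw [← hEv]; exact hEvG)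
  obtain ⟨π, hπ⟩ : ∃ π : MvPolynomial {j : Fin h // j ≠ i} R →+*
      MvPolynomial {j : Fin h // j ≠ i} (R ⧸ P), π = MvPolynomial.map (Ideal.Quotient.mk P) := ⟨_, rfl⟩
  have hπsurj : Function.Surjective π :=
    hπ ▸ MvPolynomial.map_surjective _ Ideal.Quotient.mk_surjective
  have hkerπ : RingHom.ker π = Ideal.map MvPolynomial.C (Ideal.span (Set.range c)) := by
    rw [hπ, MvPolynomial.ker_map, Ideal.mk_ker, hcP]
  have hkerN : RingHom.ker π ≤ N := by
    rw [hkerπ, Ideal.map_le_iff_le_comap]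
    intro r hr
    rw [Ideal.mem_comap, hNmem, hEvCst]
    exact (hvm r).1 (hPle (hcP ▸ hr))
  obtain ⟨Nb, hNb⟩ : ∃ Nb : Ideal (MvPolynomial {j : Fin h // j ≠ i} (R ⧸ P)), Nb = N.map π :=
    ⟨_, rfl⟩
  haveI hNbprime : Nb.IsPrime := hNb ▸ Ideal.map_isPrime_of_surjective hπsurj hkerN
  have hcomapNb : Nb.comap π = N := by
    rw [hNb, Ideal.comap_map_of_surjective π hπsurj, ← RingHom.ker_eq_comap_bot, sup_eq_left.2 hkerN]
  have hπG : π G = 0 := by rw [← RingHom.mem_ker, hkerπ]; exact hGmem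
  haveI : CharP (R ⧸ P) 2 := by
    refine CharTwo.of_one_ne_zero_of_two_eq_zero one_ne_zero ?_
    rw [show (2 : R ⧸ P) = Ideal.Quotient.mk P 2 from (map_ofNat _ 2).symm, CharTwo.two_eq_zero,
      map_zero]
  have hπQ : π Qt = ∑ a : {j : Fin h // j ≠ i}, ∑ b : {j : Fin h // j ≠ i},
        MvPolynomial.C (Ideal.Quotient.mk P (q (a.1, b.1))) * MvPolynomial.X a * MvPolynomial.X b +
      ∑ b : {j : Fin h // j ≠ i}, MvPolynomial.C (Ideal.Quotient.mk P (q (b.1, i) + q (i, b.1))) *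
        MvPolynomial.X b + MvPolynomial.C (Ideal.Quotient.mk P (q (i, i))) := by
    rw [hQt, hπ]
    simp only [map_add, map_sum, map_mul, MvPolynomial.map_C, MvPolynomial.map_X]
  have hGeq : π U ^ 2 * π Qt - π (A * u₁) ^ 2 = π (W * u₁ * u₂ ^ 2) := by
    have := hπG
    rw [hG] at this
    simp only [map_sub, map_mul, map_pow] at this ⊢
    linear_combination this
  have hrel : π U ^ 2 * (∑ a : {j : Fin h // j ≠ i}, ∑ b : {j : Fin h // j ≠ i},
        MvPolynomial.C (Ideal.Quotient.mk P (q (a.1, b.1))) * MvPolynomial.X a * MvPolynomial.X b +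
      ∑ b : {j : Fin h // j ≠ i}, MvPolynomial.C (Ideal.Quotient.mk P (q (b.1, i) + q (i, b.1))) *
        MvPolynomial.X b + MvPolynomial.C (Ideal.Quotient.mk P (q (i, i)))) - π (A * u₁) ^ 2 ∈
      Nb ^ 3 := by
    rw [← hπQ, hGeq, hNb, ← Ideal.map_pow]
    apply Ideal.mem_map_of_mem
    exact Ideal.mul_mem_right _ _ (Ideal.mul_mem_right _ _ hW)
  have hπU : π U ∉ Nb := by
    intro hmem
    have hUN : U ∈ N := by rw [← hcomapNb]; exact hmem
    rw [hNmem, hU, map_mul, map_mul, hu₂, hu₁, mul_one] at hUN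
    exact lt_irrefl _ hUN
  -- THE DERIVATION ARGUMENT
  obtain ⟨hpol, hlin⟩ := polar_mem_of_sq_congr Nb (fun a b : {j : Fin h // j ≠ i} =>
    Ideal.Quotient.mk P (q (a.1, b.1))) (fun b => Ideal.Quotient.mk P (q (b.1, i) + q (i, b.1)))
    (Ideal.Quotient.mk P (q (i, i))) hπU hrel
  have hback : ∀ r : R, (MvPolynomial.C (Ideal.Quotient.mk P r) :
      MvPolynomial {j : Fin h // j ≠ i} (R ⧸ P)) ∈ Nb → r ∈ maximalIdeal R := by
    intro r hr
    have h1 : MvPolynomial.C r ∈ N := by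
      rw [← hcomapNb, Ideal.mem_comap, hπ, MvPolynomial.map_C]
      exact hr
    rw [hNmem, hEvCst] at h1
    exact (hvm r).2 h1
  have hpolar : ∀ a b : Fin h, a ≠ b → q (a, b) + q (b, a) ∈ maximalIdeal R := by
    intro a b hab
    by_cases ha : a = i
    · subst ha
      have := hback _ (hlin ⟨b, Ne.symm hab⟩)
      rwa [add_comm] at this
    · by_cases hb : b = i
      · subst hb
        exact hback _ (hlin ⟨a, hab⟩)
      · have := hpol ⟨a, ha⟩ ⟨b, hb⟩ (fun h0 => hab (congrArg Subtype.val h0))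
        rw [← map_add] at this
        exact hback _ this
  -- the OLD stage is high-order: contradiction
  obtain ⟨b, hb⟩ := exists_sq_congr_of_polar_mem (maximalIdeal R) hperf (fun j => c j) hcm
    (fun a b => q (a, b)) hpolar
  have hsum : (∑ a, ∑ b', q (a, b') * c a * c b') = f - g₀ ^ 2 := by
    rw [← hq, Fintype.sum_prod_type]
    apply Finset.sum_congr rfl; intro a _
    apply Finset.sum_congr rfl; intro b' _
    ring
  rw [hsum] at hb
  apply hlow (g₀ + b)
  rw [CharTwo.add_sq, ← sub_sub]
  exact hb

end Summit.ResolutionOfSingularities.ResolutionOfSingularities.Theorems.SwitchingDichotomy.LowOrderAbsorbing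

end
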